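import Literature.Combinatorics.SimpleGraph.MatchingMinorBicontraction
import Literature.Combinatorics.SimpleGraph.MatchingMinorCentral
import HarnessLib

/-!
# Matching minors of a bicontraction are matching minors (lifting central subgraphs)

Topic `Combinatorics/SimpleGraph`; theorems only. Tools for the hard direction of Little's theorem
(`Little1975_isPfaffianBipartite_iff_not_isMatchingMinor`, `LittleTheorem.lean`): the descending
induction bicontracts a vertex of degree two of a non-Pfaffian graph `G₀` (normal position:
`RowZeroBicontractible G₀`, `bicontractRowZero G₀`, `MatchingMinor.lean`), finds a `K_{3,3}` matching
minor in the bicontraction, and must lift it back to `G₀`. This file proves the lifting: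

* `isCentralSubgraph_of_injective` — a convenient constructor of `IsCentralSubgraph` data: the
  complementary perfect matching may be given as an injective function on the complementary rows
  (bijectivity onto the complementary columns is a cardinality count);
* `IsMatchingMinor.of_bicontractRowZero` — **if `H` is a matching minor of `bicontractRowZero G₀`
  then `H` is a matching minor of `G₀`** (transitivity of weak containment through one
  bicontraction; Robertson–Seymour–Thomas 1999 §4 use it tacitly). Proof: let `K'` be the central
  subgraph of the bicontraction that bicontracts to `H`. If `K'` avoids the merged column, `K'`
  itself is central in `G₀` (shift indices; row `0` of `G₀` and the row formerly matched to the
  merged column are re-matched inside `{column 0, column 1}`). If `K'` uses the merged column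
  (w.l.o.g. as its column `0`, after a relabelling), un-bicontract: the graph `liftK` on one more
  row and column (row `0` joined to the columns `0, 1`; an edge of `K'` into the merged column is
  resolved to column `0` and/or `1` of `G₀` according to which of the two edges exist in `G₀`) is
  central in `G₀`, is in normal position, and bicontracts to `K'` exactly.

## References

* N. Robertson, P. D. Seymour, R. Thomas, *Permanents, Pfaffian orientations, and even directed
  circuits*, Ann. of Math. 150 (1999) 929–975, §4 (bicontraction, weak containment).
  [RobertsonSeymourThomas1999]
-/

namespace Literature.Combinatorics.SimpleGraph

open Equiv Finset

/-! ### A constructor for central subgraphs -/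

section Constructor

variable {k n : ℕ}

/-- **Central subgraph from an injective complementary matching.** Row/column embeddings sending
edges to edges, and a function `f` matching every complementary row `i ∉ range r` to a
complementary column `f i ∉ range c` along an edge of `G`, injectively; then `f` is a bijection
onto the complementary columns (both complements have `n - k` elements) and `K` is central in `G`.
[folklore] -/
theorem isCentralSubgraph_of_injective {K : Finset (Fin k × Fin k)} {G : Finset (Fin n × Fin n)}
    (r c : Fin k ↪ Fin n) (hK : ∀ e ∈ K, (r e.1, c e.2) ∈ G) (f : Fin n → Fin n)
    (hmem : ∀ i, i ∉ Set.range r → (i, f i) ∈ G)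
    (hcompl : ∀ i, i ∉ Set.range r → f i ∉ Set.range c)
    (hinj : ∀ i i', i ∉ Set.range r → i' ∉ Set.range r → f i = f i' → i = i') :
    IsCentralSubgraph K G := by
  classical
  let F : {i : Fin n // i ∉ Set.range r} → {j : Fin n // j ∉ Set.range c} :=
    fun i => ⟨f i, hcompl i i.2⟩
  have hF : Function.Injective F := fun i i' h =>
    Subtype.ext (hinj i i' i.2 i'.2 (congrArg Subtype.val h))
  have hrange : ∀ (g : Fin k ↪ Fin n) [Fintype {x : Fin n // x ∈ Set.range g}],
      Fintype.card {x : Fin n // x ∈ Set.range g} = k := by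
    intro g _
    rw [Fintype.card_of_subtype (Finset.univ.map g) (fun x => by simp [Finset.mem_map])]
    simp
  have hcr : Fintype.card {i : Fin n // i ∉ Set.range r} = n - k := by
    rw [Fintype.card_subtype_compl, Fintype.card_fin, hrange r]
  have hcc : Fintype.card {j : Fin n // j ∉ Set.range c} = n - k := by
    rw [Fintype.card_subtype_compl, Fintype.card_fin, hrange c]
  have hbij : Function.Bijective F :=
    (Fintype.bijective_iff_injective_and_card F).2 ⟨hF, hcr.trans hcc.symm⟩
  exact ⟨r, c, hK, Equiv.ofBijective F hbij, fun i => hmem i i.2⟩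

end Constructor

/-! ### Lifting a central subgraph through a bicontraction -/

section Lift

variable {k m : ℕ}

/-- The embedding `0 ↦ 0`, `x + 1 ↦ (g x) + 1` of `Fin (k + 1)` into `Fin (m + 2)` built from an
embedding `g : Fin k ↪ Fin (m + 1)`. [folklore] -/
theorem exists_succEmbedding (g : Fin k ↪ Fin (m + 1)) :
    ∃ G : Fin (k + 1) ↪ Fin (m + 2), G 0 = 0 ∧ ∀ x, G x.succ = (g x).succ := by
  refine ⟨⟨fun i => Fin.cases 0 (fun x => (g x).succ) i, ?_⟩, rfl, fun x => rfl⟩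
  intro i i' h
  induction i using Fin.cases with
  | zero =>
    induction i' using Fin.cases with
    | zero => rfl
    | succ x' => exact absurd (h.symm.trans rfl) (Fin.succ_ne_zero _)
  | succ x =>
    induction i' using Fin.cases with
    | zero => exact absurd h (Fin.succ_ne_zero _)
    | succ x' =>
      have h' : (g x).succ = (g x').succ := h
      rw [g.injective (Fin.succ_injective _ h')]

/-- Edges of the bicontraction whose column is not the merged column come from shifted edges of
`G₀`. [folklore] -/
theorem mem_of_mem_bicontractRowZero_of_ne {G₀ : Finset (Fin (m + 2) × Fin (m + 2))}
    {a b : Fin (m + 1)} (h : (a, b) ∈ bicontractRowZero G₀) (hb : b ≠ 0) :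
    (a.succ, b.succ) ∈ G₀ := by
  rcases (mem_bicontractRowZero_iff G₀ a b).1 h with h1 | ⟨h1, -⟩
  · exact h1
  · exact absurd h1 hb

/-- **Case 1 of the lifting**: a central subgraph of the bicontraction avoiding the merged column
is central in `G₀`. [folklore] -/
theorem IsCentralSubgraph.of_bicontractRowZero_of_notMem {G₀ : Finset (Fin (m + 2) × Fin (m + 2))}
    (hrow : RowZeroBicontractible G₀) {K' : Finset (Fin k × Fin k)} (r' c' : Fin k ↪ Fin (m + 1))
    (hK' : ∀ e ∈ K', (r' e.1, c' e.2) ∈ bicontractRowZero G₀)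
    (τ' : {i : Fin (m + 1) // i ∉ Set.range r'} ≃ {j : Fin (m + 1) // j ∉ Set.range c'})
    (hτ' : ∀ i : {i : Fin (m + 1) // i ∉ Set.range r'},
      ((i : Fin (m + 1)), ((τ' i : _) : Fin (m + 1))) ∈ bicontractRowZero G₀)
    (h0 : (0 : Fin (m + 1)) ∉ Set.range c') : IsCentralSubgraph K' G₀ := by
  classical
  have h00 : ((0 : Fin (m + 2)), (0 : Fin (m + 2))) ∈ G₀ := (hrow.zero_mem_iff 0).2 (Or.inl rfl)
  have h01 : ((0 : Fin (m + 2)), (1 : Fin (m + 2))) ∈ G₀ := (hrow.zero_mem_iff 1).2 (Or.inr rfl)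
  -- the row of the bicontraction matched with the merged column
  set a₀ : {i : Fin (m + 1) // i ∉ Set.range r'} := τ'.symm ⟨0, h0⟩ with ha₀
  have hτa₀ : ((τ' a₀ : _) : Fin (m + 1)) = 0 := by rw [ha₀, Equiv.apply_symm_apply]
  have hτne : ∀ x : {i : Fin (m + 1) // i ∉ Set.range r'}, x ≠ a₀ →
      ((τ' x : _) : Fin (m + 1)) ≠ 0 := by
    intro x hx h
    apply hx
    apply τ'.injective
    exact Subtype.ext (h.trans hτa₀.symm)
  -- the value of `τ'` extended by junk
  let τv : Fin (m + 1) → Fin (m + 1) := fun a =>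
    if h : a ∈ Set.range r' then 0 else ((τ' ⟨a, h⟩ : _) : Fin (m + 1))
  have hτv : ∀ x : {i : Fin (m + 1) // i ∉ Set.range r'}, τv x = ((τ' x : _) : Fin (m + 1)) := by
    intro x
    have hx : (x : Fin (m + 1)) ∉ Set.range r' := x.2
    simp only [τv, dif_neg hx]
  -- resolve the merged edge of `a₀`
  set hA : Prop := (((a₀ : Fin (m + 1)).succ, (1 : Fin (m + 2))) ∈ G₀) with hAdef
  have hB : ¬ hA → (((a₀ : Fin (m + 1)).succ, (0 : Fin (m + 2))) ∈ G₀) := by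
    intro hnA
    have h := hτ' a₀
    rw [hτa₀, mem_bicontractRowZero_iff, Fin.succ_zero_eq_one] at h
    rcases h with h | ⟨-, h⟩
    · exact absurd h hnA
    · exact h
  -- the complementary matching of `G₀`
  let f : Fin (m + 2) → Fin (m + 2) := fun i => Fin.cases (if hA then 0 else 1)
    (fun a => if a = (a₀ : Fin (m + 1)) then (if hA then 1 else 0) else (τv a).succ) i
  have hf0 : f 0 = if hA then 0 else 1 := rfl
  have hfa₀ : f (a₀ : Fin (m + 1)).succ = if hA then 1 else 0 := by
    show (if (a₀ : Fin (m + 1)) = a₀ then _ else _) = _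
    rw [if_pos rfl]
  have hfx : ∀ x : {i : Fin (m + 1) // i ∉ Set.range r'}, x ≠ a₀ →
      f (x : Fin (m + 1)).succ = ((τ' x : _) : Fin (m + 1)).succ := by
    intro x hx
    show (if (x : Fin (m + 1)) = a₀ then _ else (τv x).succ) = _
    rw [if_neg (fun h => hx (Subtype.ext h)), hτv]
  -- rows of `G₀` outside `range (succ ∘ r')` are `0` and the successors of rows outside `range r'`
  obtain ⟨R, hR0, hRs⟩ := exists_succEmbedding r'
  obtain ⟨C, hC0, hCs⟩ := exists_succEmbedding c'
  -- we only use the successor parts of `R`, `C`: restrict to `Fin k` via `Fin.succEmb`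
  let r : Fin k ↪ Fin (m + 2) := r'.trans (Fin.succEmb (m + 1))
  let c : Fin k ↪ Fin (m + 2) := c'.trans (Fin.succEmb (m + 1))
  have hr : ∀ x, r x = (r' x).succ := fun x => rfl
  have hc : ∀ y, c y = (c' y).succ := fun y => rfl
  clear hR0 hRs hC0 hCs R C
  have hcompl_row : ∀ i : Fin (m + 2), i ∉ Set.range r →
      i = 0 ∨ ∃ x : {i : Fin (m + 1) // i ∉ Set.range r'}, i = (x : Fin (m + 1)).succ := by
    intro i hi
    induction i using Fin.cases with
    | zero => exact Or.inl rfl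
    | succ a =>
      refine Or.inr ⟨⟨a, fun ⟨x, hx⟩ => hi ⟨x, ?_⟩⟩, rfl⟩
      rw [hr, hx]
  have hnot_c : ∀ j : Fin (m + 2), j ∈ Set.range c ↔ ∃ y, (c' y).succ = j := by
    intro j; exact Iff.rfl
  have h0c : (0 : Fin (m + 2)) ∉ Set.range c := fun ⟨y, hy⟩ => Fin.succ_ne_zero _ hy
  have h1c : (1 : Fin (m + 2)) ∉ Set.range c := fun ⟨y, hy⟩ =>
    h0 ⟨y, (succ_eq_one_iff _).1 hy⟩
  refine isCentralSubgraph_of_injective r c (fun e he => ?_) f ?_ ?_ ?_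
  · -- edges
    rw [hr, hc]
    exact mem_of_mem_bicontractRowZero_of_ne (hK' e he) fun h => h0 ⟨e.2, h⟩
  · -- matched along edges
    intro i hi
    rcases hcompl_row i hi with rfl | ⟨x, rfl⟩
    · rw [hf0]; split_ifs
      · exact h00
      · exact h01
    · by_cases hx : x = a₀
      · rw [hx, hfa₀]
        by_cases hAh : hA
        · rw [if_pos hAh]; exact hAh
        · rw [if_neg hAh]; exact hB hAh
      · rw [hfx x hx]
        exact mem_of_mem_bicontractRowZero_of_ne (hτ' x) (hτne x hx)
  · -- into the complementary columns
    intro i hi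
    rcases hcompl_row i hi with rfl | ⟨x, rfl⟩
    · rw [hf0]; split_ifs
      · exact h0c
      · exact h1c
    · by_cases hx : x = a₀
      · rw [hx, hfa₀]; split_ifs
        · exact h1c
        · exact h0c
      · rw [hfx x hx]
        rintro ⟨y, hy⟩
        exact (τ' x).2 ⟨y, Fin.succ_injective _ hy⟩
  · -- injective on the complementary rows
    intro i i' hi hi' hff
    rcases hcompl_row i hi with rfl | ⟨x, rfl⟩ <;> rcases hcompl_row i' hi' with h' | ⟨x', h'⟩
    · exact h'.symm
    · subst h'
      exfalso
      by_cases hx : x' = a₀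
      · rw [hf0, hx, hfa₀] at hff
        split_ifs at hff <;> simp at hff
      · rw [hf0, hfx x' hx] at hff
        split_ifs at hff
        · exact Fin.succ_ne_zero _ hff.symm
        · exact hτne x' hx ((succ_eq_one_iff _).1 hff.symm)
    · subst h'
      exfalso
      by_cases hx : x = a₀
      · rw [hf0, hx, hfa₀] at hff
        split_ifs at hff <;> simp at hff
      · rw [hf0, hfx x hx] at hff
        split_ifs at hff
        · exact Fin.succ_ne_zero _ hff
        · exact hτne x hx ((succ_eq_one_iff _).1 hff)
    · subst h'
      by_cases hx : x = a₀ <;> by_cases hx' : x' = a₀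
      · rw [hx, hx']
      · exfalso
        rw [hx, hfa₀, hfx x' hx'] at hff
        split_ifs at hff
        · exact hτne x' hx' ((succ_eq_one_iff _).1 hff.symm)
        · exact Fin.succ_ne_zero _ hff.symm
      · exfalso
        rw [hx', hfa₀, hfx x hx] at hff
        split_ifs at hff
        · exact hτne x hx ((succ_eq_one_iff _).1 hff)
        · exact Fin.succ_ne_zero _ hff
      · rw [hfx x hx, hfx x' hx'] at hff
        have := τ'.injective (Subtype.ext (Fin.succ_injective _ hff))
        rw [this]

/-- **Case 2 of the lifting (un-bicontraction)**: a central subgraph `K'` of the bicontraction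
whose column `0` is the merged column lifts to a central subgraph of `G₀` in normal position whose
bicontraction is `K'`. [folklore] -/
theorem exists_lift_of_bicontractRowZero {G₀ : Finset (Fin (m + 2) × Fin (m + 2))}
    (hrow : RowZeroBicontractible G₀) {K' : Finset (Fin (k + 1) × Fin (k + 1))}
    (r' c' : Fin (k + 1) ↪ Fin (m + 1)) (hK' : ∀ e ∈ K', (r' e.1, c' e.2) ∈ bicontractRowZero G₀)
    (τ' : {i : Fin (m + 1) // i ∉ Set.range r'} ≃ {j : Fin (m + 1) // j ∉ Set.range c'})
    (hτ' : ∀ i : {i : Fin (m + 1) // i ∉ Set.range r'},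
      ((i : Fin (m + 1)), ((τ' i : _) : Fin (m + 1))) ∈ bicontractRowZero G₀)
    (hc0 : c' 0 = 0) :
    ∃ K : Finset (Fin (k + 2) × Fin (k + 2)),
      IsCentralSubgraph K G₀ ∧ RowZeroBicontractible K ∧ bicontractRowZero K = K' := by
  classical
  have h00 : ((0 : Fin (m + 2)), (0 : Fin (m + 2))) ∈ G₀ := (hrow.zero_mem_iff 0).2 (Or.inl rfl)
  have h01 : ((0 : Fin (m + 2)), (1 : Fin (m + 2))) ∈ G₀ := (hrow.zero_mem_iff 1).2 (Or.inr rfl)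
  -- the lift, by its membership predicate
  let P : Fin (k + 2) × Fin (k + 2) → Prop := fun e =>
    Fin.cases (e.2 = 0 ∨ e.2 = 1)
      (fun x => Fin.cases ((x, (0 : Fin (k + 1))) ∈ K' ∧ ((r' x).succ, (0 : Fin (m + 2))) ∈ G₀)
        (fun y => (x, y) ∈ K' ∧ ((r' x).succ, (c' y).succ) ∈ G₀) e.2) e.1
  let K : Finset (Fin (k + 2) × Fin (k + 2)) := Finset.univ.filter P
  have hK0 : ∀ j : Fin (k + 2), ((0 : Fin (k + 2)), j) ∈ K ↔ j = 0 ∨ j = 1 := by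
    intro j; simp [K, P]
  have hKss : ∀ (x y : Fin (k + 1)), (x.succ, y.succ) ∈ K ↔
      (x, y) ∈ K' ∧ ((r' x).succ, (c' y).succ) ∈ G₀ := by
    intro x y; simp [K, P]
  have hKs0 : ∀ x : Fin (k + 1), (x.succ, (0 : Fin (k + 2))) ∈ K ↔
      (x, (0 : Fin (k + 1))) ∈ K' ∧ ((r' x).succ, (0 : Fin (m + 2))) ∈ G₀ := by
    intro x; simp [K, P]
  refine ⟨K, ?_, ?_, ?_⟩
  · -- central in `G₀`
    obtain ⟨r, hr0, hrs⟩ := exists_succEmbedding r'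
    obtain ⟨c, hc0', hcs⟩ := exists_succEmbedding c'
    let τv : Fin (m + 1) → Fin (m + 1) := fun a =>
      if h : a ∈ Set.range r' then 0 else ((τ' ⟨a, h⟩ : _) : Fin (m + 1))
    have hτv : ∀ x : {i : Fin (m + 1) // i ∉ Set.range r'}, τv x = ((τ' x : _) : Fin (m + 1)) := by
      intro x
      have hx : (x : Fin (m + 1)) ∉ Set.range r' := x.2
      simp only [τv, dif_neg hx]
    have hτne : ∀ x : {i : Fin (m + 1) // i ∉ Set.range r'}, ((τ' x : _) : Fin (m + 1)) ≠ 0 := by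
      intro x h
      exact (τ' x).2 ⟨0, hc0.trans h.symm⟩
    let f : Fin (m + 2) → Fin (m + 2) := fun i => Fin.cases 0 (fun a => (τv a).succ) i
    have hfx : ∀ x : {i : Fin (m + 1) // i ∉ Set.range r'},
        f (x : Fin (m + 1)).succ = ((τ' x : _) : Fin (m + 1)).succ := by
      intro x
      show (τv x).succ = _
      rw [hτv]
    have hcompl_row : ∀ i : Fin (m + 2), i ∉ Set.range r →
        ∃ x : {i : Fin (m + 1) // i ∉ Set.range r'}, i = (x : Fin (m + 1)).succ := by
      intro i hi
      induction i using Fin.cases with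
      | zero => exact absurd ⟨0, hr0⟩ hi
      | succ a =>
        refine ⟨⟨a, fun ⟨x, hx⟩ => hi ⟨x.succ, ?_⟩⟩, rfl⟩
        rw [hrs, hx]
    refine isCentralSubgraph_of_injective r c (fun e he => ?_) f ?_ ?_ ?_
    · -- edges of `K` are edges of `G₀`
      obtain ⟨i, j⟩ := e
      induction i using Fin.cases with
      | zero =>
        rw [hr0]
        rcases (hK0 j).1 he with rfl | rfl
        · rw [hc0']; exact h00
        · rw [← Fin.succ_zero_eq_one, hcs, hc0, Fin.succ_zero_eq_one]; exact h01
      | succ x =>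
        rw [hrs]
        induction j using Fin.cases with
        | zero => rw [hc0']; exact ((hKs0 x).1 he).2
        | succ y => rw [hcs]; exact ((hKss x y).1 he).2
    · intro i hi
      obtain ⟨x, rfl⟩ := hcompl_row i hi
      rw [hfx]
      exact mem_of_mem_bicontractRowZero_of_ne (hτ' x) (hτne x)
    · intro i hi
      obtain ⟨x, rfl⟩ := hcompl_row i hi
      rw [hfx]
      rintro ⟨j, hj⟩
      induction j using Fin.cases with
      | zero => rw [hc0'] at hj; exact Fin.succ_ne_zero _ hj.symm
      | succ y => rw [hcs] at hj; exact (τ' x).2 ⟨y, Fin.succ_injective _ hj⟩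
    · intro i i' hi hi' hff
      obtain ⟨x, rfl⟩ := hcompl_row i hi
      obtain ⟨x', rfl⟩ := hcompl_row i' hi'
      rw [hfx, hfx] at hff
      have := τ'.injective (Subtype.ext (Fin.succ_injective _ hff))
      rw [this]
  · -- normal position
    ext ⟨i, j⟩
    simp only [Finset.mem_filter, Finset.mem_insert, Finset.mem_singleton, Prod.mk.injEq]
    constructor
    · rintro ⟨hmem, rfl⟩
      rcases (hK0 j).1 hmem with rfl | rfl
      · exact Or.inl ⟨rfl, rfl⟩
      · exact Or.inr ⟨rfl, rfl⟩
    · rintro (⟨rfl, rfl⟩ | ⟨rfl, rfl⟩)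
      · exact ⟨(hK0 0).2 (Or.inl rfl), rfl⟩
      · exact ⟨(hK0 1).2 (Or.inr rfl), rfl⟩
  · -- the bicontraction of the lift is `K'`
    ext ⟨a, b⟩
    rw [mem_bicontractRowZero_iff, hKss, hKs0]
    constructor
    · rintro (⟨h, -⟩ | ⟨rfl, h, -⟩) <;> exact h
    · intro hab
      rcases (mem_bicontractRowZero_iff G₀ (r' a) (c' b)).1 (hK' _ hab) with h | ⟨hb, h⟩
      · exact Or.inl ⟨hab, h⟩
      · have hb0 : b = 0 := c'.injective (hb.trans hc0.symm)
        subst hb0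
        exact Or.inr ⟨rfl, hab, h⟩

/-- **A matching minor of a bicontraction of `G₀` is a matching minor of `G₀`** (normal
position). With `MatchingMinorCentral.lean` (`IsMatchingMinor.of_relabel_host`,
`IsMatchingMinor.of_transposeEdges_host`) this lifts matching minors through the bicontraction of
any vertex of degree two. [cite: RobertsonSeymourThomas1999, §4 (weak containment)] -/
theorem IsMatchingMinor.of_bicontractRowZero {l : ℕ} {H : Finset (Fin l × Fin l)}
    {G₀ : Finset (Fin (m + 2) × Fin (m + 2))} (hrow : RowZeroBicontractible G₀)
    (h : IsMatchingMinor H (bicontractRowZero G₀)) : IsMatchingMinor H G₀ := by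
  classical
  obtain ⟨k, K', ⟨r', c', hK', τ', hτ'⟩, hB⟩ := h
  by_cases h0 : (0 : Fin (m + 1)) ∈ Set.range c'
  · -- Case 2: the merged column is a column of `K'`; move it to index `0`
    obtain ⟨y₀, hy₀⟩ := h0
    cases k with
    | zero => exact y₀.elim0
    | succ k =>
      set K'' : Finset (Fin (k + 1) × Fin (k + 1)) := relabel K' (Equiv.refl _) (swap 0 y₀) with hK''
      let c'' : Fin (k + 1) ↪ Fin (m + 1) := (swap 0 y₀).toEmbedding.trans c'
      have hc''0 : c'' 0 = 0 := by simp [c'', hy₀]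
      have hK''mem : ∀ e ∈ K'', (r' e.1, c'' e.2) ∈ bicontractRowZero G₀ := by
        intro e he
        rw [hK'', mem_relabel_iff] at he
        simpa [c''] using hK' _ he
      have hrange : Set.range c'' = Set.range c' := by
        ext j
        constructor
        · rintro ⟨y, rfl⟩; exact ⟨swap 0 y₀ y, rfl⟩
        · rintro ⟨y, rfl⟩; exact ⟨swap 0 y₀ y, by simp [c'', swap_apply_self]⟩
      let τ'' : {i : Fin (m + 1) // i ∉ Set.range r'} ≃ {j : Fin (m + 1) // j ∉ Set.range c''} :=
        τ'.trans (Equiv.subtypeEquivRight fun j => by rw [hrange])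
      have hτ'' : ∀ i : {i : Fin (m + 1) // i ∉ Set.range r'},
          ((i : Fin (m + 1)), ((τ'' i : _) : Fin (m + 1))) ∈ bicontractRowZero G₀ :=
        fun i => hτ' i
      obtain ⟨K, hcen, hrowK, hbic⟩ := exists_lift_of_bicontractRowZero hrow r' c'' hK''mem τ'' hτ''
        hc''0
      have hB'' : Bicontracts K'' H :=
        hB.of_isIsomorphic_left (isIsomorphic_relabel K' (Equiv.refl _) (swap 0 y₀))
      exact ⟨k + 2, K, hcen, Bicontracts.step ⟨K, IsIsomorphic.refl K, hrowK,
        hbic ▸ IsIsomorphic.refl _⟩ hB''⟩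
  · -- Case 1: the merged column is not used
    exact ⟨k, K', IsCentralSubgraph.of_bicontractRowZero_of_notMem hrow r' c' hK' τ' hτ' h0, hB⟩

end Lift

end Literature.Combinatorics.SimpleGraph
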